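import Literature.Probability.LatticeModels.LatticeOrientFrame
import HarnessLib

/-!
# The lattice corridor: a Harnack chain from the window above the pole to the top side of the rectangle at the normalisation point

Topic `Literature/Probability/LatticeModels` (lattice bookkeeping for the a-priori lower bound
`G_V(a, b) ≳ δ²` in the proof of Chelkak–Smirnov 2011, Thm. 3.13, tree fact
`ChelkakSmirnov2011_boundaryNormalisedPoissonKernelLimit`; continues `LatticeOrientFrame.lean`).

Given the two frames `oy` (at the pole `b`) and `ox` (at the normalisation point `a`), macroscopic
chain points `z 0, …, z J` with closed discs `closedBall (z j) ε₀ ⊆ D` and consecutive distance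
`≤ ℓ` (`RandomPlanarGeometry.exists_chain_closedBall_subset`), and the lattice scales `t, S, T, k`,
the chain `corridorChain` (in the `oy`-frame) starts at the axis point
`((σ_y b)₀, (σ_y b)₁ + t - 1)` of the window above `σ_y b` (`frameStart`), follows the nearest
sites of the `z j`, and then sweeps along the top side of the `ox`-frame rectangle
`rectInterior ((σₓ a)₀ - S, (σₓ a)₁ - 1) (2S) T` in steps of `12k` (`sweepCentre`). We verify the
hypotheses `hboxes` (`mW_corridorChain_subset`: every big box lies in `Λ' ∖ {σ_y b}`) and `hsteps`
(`corridorChain_step`: consecutive centres lie in each other's small boxes) of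
`BoundaryPoleGreenBounds.dirichletGreen_chain_ge`, and the covering of the top side by the final
small boxes (`exists_mem_mB_corridorChain`), from: the window properties at `b` and at `a`, the
interior discs, `b` having a neighbour outside `V`, `b` far from `a`, and smallness of the mesh.

Everything is proved, [folklore].
-/

noncomputable section

namespace Literature.Probability.LatticeModels

open _root_.Complex Metric Set

/-! ## The lattice corridor

Given the two frames `oy` (at the pole `b`) and `ox` (at the normalisation point `a`), macroscopic
chain points `z 0, …, z J` (from `InteriorChain`), and the lattice scales `t, S, T, k`, the chain
`corridorChain` (in the `oy`-frame) starts at the axis point `((σ_y b)₀, (σ_y b)₁ + t - 1)` of the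
window above `σ_y b`, follows the nearest sites of the `z j`, and then sweeps along the top side
of the `ox`-frame rectangle `rectInterior ((σₓ a)₀ - S, (σₓ a)₁ - 1) (2S) T` in steps of `12k`.
The lemmas below verify the hypotheses `hboxes`, `hsteps` of `dirichletGreen_chain_ge` and the
covering of the top side by the final boxes, from: the two window properties, the interior discs
`closedBall (z j) ε₀ ⊆ D`, and smallness of the mesh. -/

section Corridor

open Orient

variable {δ : ℝ}

/-- Sup-distance of two sites from the distance of their mesh points. [folklore] -/
private theorem abs_sub_le_of_norm_meshPoint_sub_le (hδ : 0 < δ) {v v' : Site 2} {R : ℝ}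
    (h : ‖meshPoint δ v - meshPoint δ v'‖ ≤ δ * R) :
    |((v 0 - v' 0 : ℤ) : ℝ)| ≤ R ∧ |((v 1 - v' 1 : ℤ) : ℝ)| ≤ R := by
  have hre := (abs_re_le_norm _).trans h
  have him := (abs_im_le_norm _).trans h
  rw [sub_re, meshPoint_re, meshPoint_re, ← mul_sub, abs_mul, abs_of_pos hδ] at hre
  rw [sub_im, meshPoint_im, meshPoint_im, ← mul_sub, abs_mul, abs_of_pos hδ] at him
  push_cast
  exact ⟨le_of_mul_le_mul_left hre hδ, le_of_mul_le_mul_left him hδ⟩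

/-- Distance of mesh points from the `ℓ¹`-distance of sites. [folklore] -/
private theorem norm_meshPoint_sub_le (hδ : 0 ≤ δ) (v v' : Site 2) :
    ‖meshPoint δ v - meshPoint δ v'‖ ≤ δ * (|((v 0 - v' 0 : ℤ) : ℝ)| + |((v 1 - v' 1 : ℤ) : ℝ)|) := by
  have h := norm_le_abs_re_add_abs_im (meshPoint δ v - meshPoint δ v')
  rw [sub_re, meshPoint_re, meshPoint_re, ← mul_sub, sub_im, meshPoint_im, meshPoint_im, ← mul_sub,
    abs_mul, abs_mul, abs_of_nonneg hδ] at h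
  push_cast
  linarith

/-- Distance of mesh points of a sup-box. [folklore] -/
theorem norm_meshPoint_sub_le_of_mem_mW (hδ : 0 ≤ δ) {c v : Site 2} {k : ℕ} (hv : v ∈ mW c k) :
    ‖meshPoint δ v - meshPoint δ c‖ ≤ δ * (96 * k) := by
  obtain ⟨h0, h1⟩ := hv
  have h0' : |((v 0 - c 0 : ℤ) : ℝ)| ≤ 48 * k := by exact_mod_cast h0
  have h1' : |((v 1 - c 1 : ℤ) : ℝ)| ≤ 48 * k := by exact_mod_cast h1
  calc ‖meshPoint δ v - meshPoint δ c‖ ≤ δ * (|((v 0 - c 0 : ℤ) : ℝ)| + |((v 1 - c 1 : ℤ) : ℝ)|) :=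
        norm_meshPoint_sub_le hδ v c
    _ ≤ δ * (96 * k) := mul_le_mul_of_nonneg_left (by linarith) hδ

/-- Membership in a small box from the distance of mesh points. [folklore] -/
theorem mem_mB_of_norm_meshPoint_sub_le (hδ : 0 < δ) {c v : Site 2} {k : ℕ}
    (h : ‖meshPoint δ v - meshPoint δ c‖ ≤ δ * (12 * k)) : v ∈ mB c k := by
  obtain ⟨h0, h1⟩ := abs_sub_le_of_norm_meshPoint_sub_le hδ h
  constructor
  · exact_mod_cast h0
  · exact_mod_cast h1

/-- Membership in a Finset mapped by an equivalence. [folklore] -/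
theorem mem_map_frame_iff (o : Orient) (V : Finset (Site 2)) (z' : Site 2) :
    z' ∈ V.map (frame o).toEmbedding ↔ (frame o).symm z' ∈ V := Finset.mem_map_equiv

/-- The image of a site lies in the mapped Finset iff the site lies in the Finset. [folklore] -/
theorem frame_mem_map_iff (o : Orient) (V : Finset (Site 2)) (v : Site 2) :
    frame o v ∈ V.map (frame o).toEmbedding ↔ v ∈ V := by
  rw [mem_map_frame_iff, Equiv.symm_apply_apply]

/-! ### The chain -/

/-- The axis point of the window above the pole, in the frame of the pole:
`((σ b)₀, (σ b)₁ + t - 1)`. [folklore] -/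
def frameStart (oy : Orient) (b : Site 2) (t : ℕ) : Site 2 := ![frame oy b 0, frame oy b 1 + t - 1]

/-- The `m`-th sweep centre on the top side of the rectangle at `a`, in the frame of `a`:
`((σ a)₀ - S + 12km, (σ a)₁ - 1 + T)`. [folklore] -/
def sweepCentre (ox : Orient) (a : Site 2) (S T k m : ℕ) : Site 2 :=
  ![frame ox a 0 - (S : ℤ) + 12 * (k : ℤ) * (m : ℤ), frame ox a 1 - 1 + (T : ℤ)]

/-- **The corridor chain** (in the frame of the pole): the window axis point, the nearest sites of
the macroscopic chain points `z 0, …, z J`, then the sweep centres `0, …, M` (constant after). [folklore] -/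
def corridorChain (oy ox : Orient) (δ : ℝ) (a b : Site 2) (t S T k J M : ℕ) (z : ℕ → ℂ) (i : ℕ) :
    Site 2 :=
  if i = 0 then frameStart oy b t
  else if i ≤ J + 1 then frame oy (nearestSite δ (z (i - 1)))
  else frame oy ((frame ox).symm (sweepCentre ox a S T k (min (i - (J + 2)) M)))

variable {oy ox : Orient} {a b : Site 2} {t S T k J M : ℕ} {z : ℕ → ℂ}

/-- First coordinate of the axis point. [folklore] -/
@[simp] theorem frameStart_apply_zero : frameStart oy b t 0 = frame oy b 0 := rfl
/-- Second coordinate of the axis point. [folklore] -/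
@[simp] theorem frameStart_apply_one : frameStart oy b t 1 = frame oy b 1 + t - 1 := rfl
/-- First coordinate of the sweep centre. [folklore] -/
@[simp] theorem sweepCentre_apply_zero (m : ℕ) :
    sweepCentre ox a S T k m 0 = frame ox a 0 - (S : ℤ) + 12 * (k : ℤ) * (m : ℤ) := rfl
/-- Second coordinate of the sweep centre. [folklore] -/
@[simp] theorem sweepCentre_apply_one (m : ℕ) : sweepCentre ox a S T k m 1 = frame ox a 1 - 1 + (T : ℤ) := rfl

/-- The chain starts at the axis point (`hc0`, `hc1` of `dirichletGreen_chain_ge`). [folklore] -/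
theorem corridorChain_zero : corridorChain oy ox δ a b t S T k J M z 0 = frameStart oy b t := by
  simp [corridorChain]

/-- The middle part of the chain. [folklore] -/
theorem corridorChain_mid {i : ℕ} (hi1 : 1 ≤ i) (hi2 : i ≤ J + 1) :
    corridorChain oy ox δ a b t S T k J M z i = frame oy (nearestSite δ (z (i - 1))) := by
  simp [corridorChain, show i ≠ 0 by omega, hi2]

/-- The sweep part of the chain. [folklore] -/
theorem corridorChain_sweep {i : ℕ} (hi : J + 2 ≤ i) :
    corridorChain oy ox δ a b t S T k J M z i =
      frame oy ((frame ox).symm (sweepCentre ox a S T k (min (i - (J + 2)) M))) := by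
  simp [corridorChain, show i ≠ 0 by omega, show ¬ i ≤ J + 1 by omega]

/-! ### The boxes lie in the domain and avoid the pole -/

/-- **The first box** `mW (frameStart) k` lies in `Λ' ∖ {σ b}` by the window property at the pole
(`48k + 2 ≤ t`, `t + 48k ≤ W + 1`). [folklore] -/
theorem mW_frameStart_subset {V : Finset (Site 2)} {W : ℕ}
    (hwin : ∀ z' : Site 2, |z' 0 - frame oy b 0| ≤ W → |z' 1 - frame oy b 1| ≤ W →
      (z' ∈ V.map (frame oy).toEmbedding ↔ frame oy b 1 ≤ z' 1))
    (hkt : 48 * k + 2 ≤ t) (htW : t + 48 * k ≤ W + 1) :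
    mW (frameStart oy b t) k ⊆ (↑(V.map (frame oy).toEmbedding) : Set (Site 2)) \ {frame oy b} := by
  intro z' hz'
  obtain ⟨h0, h1⟩ := hz'
  rw [frameStart_apply_zero] at h0
  rw [frameStart_apply_one, abs_le] at h1
  have hkt' : (48 * k + 2 : ℤ) ≤ t := by exact_mod_cast hkt
  have htW' : (t + 48 * k : ℤ) ≤ W + 1 := by exact_mod_cast htW
  have hk48 : |z' 0 - frame oy b 0| ≤ W := h0.trans (by omega)
  refine ⟨?_, ?_⟩
  · rw [Finset.mem_coe]
    refine (hwin z' hk48 ?_).2 (by omega)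
    rw [abs_le]; constructor
    · omega
    · omega
  · intro heq
    rw [mem_singleton_iff] at heq
    rw [heq] at h1
    omega

/-- **The interior boxes** `mW (σ (nearestSite δ p)) k` lie in `Λ' ∖ {σ b}` when
`closedBall p ε₀ ⊆ D`, `96kδ + 2δ ≤ ε₀`, the sites of `V` are those with mesh point in
`closure D`, and `b` has a lattice neighbour outside `V` (within mesh distance `δ`). [folklore] -/
theorem mW_frame_nearestSite_subset (hδ : 0 < δ) {V : Finset (Site 2)} {D : Set ℂ}
    (hV : ∀ v, v ∈ V ↔ meshPoint δ v ∈ closure D) {p : ℂ} {ε₀ : ℝ} (hpD : closedBall p ε₀ ⊆ D)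
    (hk : 96 * k * δ + 2 * δ ≤ ε₀)
    (hb : ∃ u : Site 2, ‖meshPoint δ u - meshPoint δ b‖ ≤ δ ∧ u ∉ V) :
    mW (frame oy (nearestSite δ p)) k ⊆ (↑(V.map (frame oy).toEmbedding) : Set (Site 2)) \ {frame oy b} := by
  intro z' hz'
  rw [mem_mW_frame_iff] at hz'
  set v := (frame oy).symm z' with hv
  have hz'v : z' = frame oy v := by rw [hv, Equiv.apply_symm_apply]
  have hdist : dist (meshPoint δ v) p ≤ δ * (96 * k) + δ := by
    calc dist (meshPoint δ v) p ≤ dist (meshPoint δ v) (meshPoint δ (nearestSite δ p)) +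
          dist (meshPoint δ (nearestSite δ p)) p := dist_triangle _ _ _
      _ ≤ δ * (96 * k) + δ := add_le_add (by rw [dist_eq_norm]; exact norm_meshPoint_sub_le_of_mem_mW hδ.le hz')
          (dist_meshPoint_nearestSite_le hδ p)
  refine ⟨?_, ?_⟩
  · rw [Finset.mem_coe, hz'v, frame_mem_map_iff, hV]
    exact subset_closure (hpD (by rw [mem_closedBall]; linarith))
  · intro heq
    rw [mem_singleton_iff] at heq
    have hvb : v = b := by rw [hv, heq, Equiv.symm_apply_apply]
    obtain ⟨u, hu, huV⟩ := hb
    apply huV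
    rw [hV]
    apply subset_closure
    apply hpD
    rw [mem_closedBall]
    calc dist (meshPoint δ u) p ≤ dist (meshPoint δ u) (meshPoint δ b) + dist (meshPoint δ b) p :=
          dist_triangle _ _ _
      _ ≤ δ + (δ * (96 * k) + δ) := add_le_add (by rw [dist_eq_norm]; exact hu) (by rw [← hvb]; exact hdist)
      _ ≤ ε₀ := by linarith

/-- **The sweep boxes** lie in `Λ' ∖ {σ b}` by the window property at `a`
(`12km ≤ 2S`, `S + 48k ≤ Wₓ`, `48k + 1 ≤ T`, `T + 48k ≤ Wₓ + 1`, and `b` far from `a` in the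
`ox`-frame). [folklore] -/
theorem mW_frame_sweepCentre_subset {V : Finset (Site 2)} {Wx m : ℕ}
    (hwinx : ∀ z' : Site 2, |z' 0 - frame ox a 0| ≤ Wx → |z' 1 - frame ox a 1| ≤ Wx →
      (z' ∈ V.map (frame ox).toEmbedding ↔ frame ox a 1 ≤ z' 1))
    (hm : 12 * k * m ≤ 2 * S) (hS : S + 48 * k ≤ Wx) (hT1 : 48 * k + 1 ≤ T) (hT2 : T + 48 * k ≤ Wx + 1)
    (hfar : (S : ℤ) + 48 * k < |frame ox b 0 - frame ox a 0| ∨ (T : ℤ) + 48 * k < |frame ox b 1 - frame ox a 1|) :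
    mW (frame oy ((frame ox).symm (sweepCentre ox a S T k m))) k ⊆
      (↑(V.map (frame oy).toEmbedding) : Set (Site 2)) \ {frame oy b} := by
  intro z' hz'
  rw [mem_mW_frame_iff] at hz'
  set v := (frame oy).symm z' with hv
  have hz'v : z' = frame oy v := by rw [hv, Equiv.apply_symm_apply]
  -- `σₓ v` lies in the box about the sweep centre
  have hbox : frame ox v ∈ mW (sweepCentre ox a S T k m) k := by
    have := (mem_mW_frame_iff ox ((frame ox).symm (sweepCentre ox a S T k m)) (frame ox v) k)
    rw [Equiv.apply_symm_apply, Equiv.symm_apply_apply] at this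
    exact this.2 hz'
  obtain ⟨h0, h1⟩ := hbox
  rw [sweepCentre_apply_zero, abs_le] at h0
  rw [sweepCentre_apply_one, abs_le] at h1
  have hm' : 12 * (k : ℤ) * (m : ℤ) ≤ 2 * (S : ℤ) := by exact_mod_cast hm
  have hkm0 : 0 ≤ 12 * (k : ℤ) * (m : ℤ) := by positivity
  have hS' : (S : ℤ) + 48 * k ≤ Wx := by exact_mod_cast hS
  have hT1' : 48 * (k : ℤ) + 1 ≤ T := by exact_mod_cast hT1
  have hT2' : (T : ℤ) + 48 * k ≤ Wx + 1 := by exact_mod_cast hT2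
  -- linear facts about the product `12 k m`
  obtain ⟨P, hP, hP0, hPS⟩ : ∃ P : ℤ, P = 12 * (k : ℤ) * (m : ℤ) ∧ 0 ≤ P ∧ P ≤ 2 * S := ⟨_, rfl, hkm0, hm'⟩
  rw [← hP] at h0
  have hin : frame ox v ∈ V.map (frame ox).toEmbedding := by
    refine (hwinx (frame ox v) ?_ ?_).2 (by omega)
    · rw [abs_le]; constructor
      · omega
      · omega
    · rw [abs_le]; constructor
      · omega
      · omega
  rw [frame_mem_map_iff] at hin
  refine ⟨?_, ?_⟩
  · rw [Finset.mem_coe, hz'v, frame_mem_map_iff]; exact hin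
  · intro heq
    rw [mem_singleton_iff] at heq
    have hvb : v = b := by rw [hv, heq, Equiv.symm_apply_apply]
    rw [hvb] at h0 h1
    rcases hfar with h | h
    · rw [lt_abs] at h; omega
    · rw [lt_abs] at h; omega

/-- `b` is far from `a` in every frame when the mesh points are far: if
`2δR < |meshPoint δ b - meshPoint δ a|` then one frame coordinate differs by more than `R`. [folklore] -/
theorem lt_abs_frame_sub_or (o : Orient) (hδ : 0 < δ) {R : ℝ}
    (h : 2 * δ * R < ‖meshPoint δ b - meshPoint δ a‖) :
    R < |((frame o b 0 - frame o a 0 : ℤ) : ℝ)| ∨ R < |((frame o b 1 - frame o a 1 : ℤ) : ℝ)| := by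
  rw [Int.cast_abs.symm, Int.cast_abs.symm, frame_apply_zero, frame_apply_zero, frame_apply_one,
    frame_apply_one]
  by_contra hcon
  rw [not_or, not_lt, not_lt] at hcon
  obtain ⟨h0, h1⟩ := hcon
  have key := norm_meshPoint_sub_le hδ.le b a
  rw [Int.cast_abs.symm, Int.cast_abs.symm] at key
  have hperm := abs_tng_abs_nrm o (b - a)
  simp only [tng_sub, nrm_sub, Pi.sub_apply] at hperm
  have hsum : ((|b 0 - a 0| : ℤ) : ℝ) + ((|b 1 - a 1| : ℤ) : ℝ) ≤ 2 * R := by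
    rcases hperm with ⟨ht, hn⟩ | ⟨ht, hn⟩
    · rw [← ht, ← hn]; linarith
    · rw [← ht, ← hn]; linarith
  have := key.trans (mul_le_mul_of_nonneg_left hsum hδ.le)
  linarith

/-- **All boxes of the corridor chain lie in `Λ' ∖ {σ b}`** (the hypothesis `hboxes` of
`dirichletGreen_chain_ge`, for every index). [folklore] -/
theorem mW_corridorChain_subset (hδ : 0 < δ) {V : Finset (Site 2)} {D : Set ℂ}
    (hV : ∀ v, v ∈ V ↔ meshPoint δ v ∈ closure D) {W Wx : ℕ}
    (hwin : ∀ z' : Site 2, |z' 0 - frame oy b 0| ≤ W → |z' 1 - frame oy b 1| ≤ W →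
      (z' ∈ V.map (frame oy).toEmbedding ↔ frame oy b 1 ≤ z' 1))
    (hwinx : ∀ z' : Site 2, |z' 0 - frame ox a 0| ≤ Wx → |z' 1 - frame ox a 1| ≤ Wx →
      (z' ∈ V.map (frame ox).toEmbedding ↔ frame ox a 1 ≤ z' 1))
    (hkt : 48 * k + 2 ≤ t) (htW : t + 48 * k ≤ W + 1)
    {ε₀ : ℝ} (hzD : ∀ j, j ≤ J → closedBall (z j) ε₀ ⊆ D) (hkε : 96 * k * δ + 2 * δ ≤ ε₀)
    (hb : ∃ u : Site 2, ‖meshPoint δ u - meshPoint δ b‖ ≤ δ ∧ u ∉ V)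
    (hM : 12 * k * M ≤ 2 * S) (hS : S + 48 * k ≤ Wx) (hT1 : 48 * k + 1 ≤ T) (hT2 : T + 48 * k ≤ Wx + 1)
    (hfar : (S : ℤ) + 48 * k < |frame ox b 0 - frame ox a 0| ∨ (T : ℤ) + 48 * k < |frame ox b 1 - frame ox a 1|)
    (i : ℕ) :
    mW (corridorChain oy ox δ a b t S T k J M z i) k ⊆
      (↑(V.map (frame oy).toEmbedding) : Set (Site 2)) \ {frame oy b} := by
  rcases Nat.eq_zero_or_pos i with hi | hi
  · rw [hi, corridorChain_zero]; exact mW_frameStart_subset hwin hkt htW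
  by_cases hi2 : i ≤ J + 1
  · rw [corridorChain_mid hi hi2]
    exact mW_frame_nearestSite_subset hδ hV (hzD (i - 1) (by omega)) hkε hb
  · push Not at hi2
    rw [corridorChain_sweep (by omega)]
    refine mW_frame_sweepCentre_subset hwinx ?_ hS hT1 hT2 hfar
    calc 12 * k * min (i - (J + 2)) M ≤ 12 * k * M := Nat.mul_le_mul_left _ (min_le_right _ _)
      _ ≤ 2 * S := hM

/-! ### Consecutive centres are close -/

/-- **Step 0**: from the axis point to the first interior centre, when the axis point's mesh point
is within `η` of `z 0` and `η + δ ≤ 12kδ`. [folklore] -/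
theorem corridorChain_step_zero (hδ : 0 < δ) {η : ℝ}
    (h0 : ‖meshPoint δ b + (δ : ℂ) * ((((t : ℤ) - 1 : ℤ) : ℝ) : ℂ) * ν oy - z 0‖ ≤ η)
    (hη : η + δ ≤ 12 * k * δ) :
    corridorChain oy ox δ a b t S T k J M z 1 ∈ mB (corridorChain oy ox δ a b t S T k J M z 0) k := by
  rw [corridorChain_zero, corridorChain_mid le_rfl (by omega), Nat.sub_self]
  -- compare in original coordinates
  have key : frame oy (nearestSite δ (z 0)) ∈ mB (frame oy ((frame oy).symm (frameStart oy b t))) k := by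
    rw [frame_mem_mB_iff]
    apply mem_mB_of_norm_meshPoint_sub_le hδ
    have hmesh : meshPoint δ ((frame oy).symm (frameStart oy b t)) =
        meshPoint δ b + (δ : ℂ) * ((((t : ℤ) - 1 : ℤ) : ℝ) : ℂ) * ν oy := by
      rw [meshPoint_frame_symm oy δ b]
      simp only [frameStart_apply_zero, frameStart_apply_one, sub_self, Int.cast_zero, ofReal_zero,
        zero_mul, zero_add]
      push_cast; ring
    rw [hmesh]
    calc ‖meshPoint δ (nearestSite δ (z 0)) - (meshPoint δ b + (δ : ℂ) * ((((t : ℤ) - 1 : ℤ) : ℝ) : ℂ) * ν oy)‖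
        ≤ ‖meshPoint δ (nearestSite δ (z 0)) - z 0‖ +
          ‖z 0 - (meshPoint δ b + (δ : ℂ) * ((((t : ℤ) - 1 : ℤ) : ℝ) : ℂ) * ν oy)‖ := norm_sub_le_norm_sub_add_norm_sub _ _ _
      _ ≤ δ + η := by
          refine add_le_add ?_ ?_
          · rw [← dist_eq_norm]; exact dist_meshPoint_nearestSite_le hδ _
          · rw [norm_sub_rev]; exact h0
      _ ≤ δ * (12 * k) := by linarith
  rwa [Equiv.apply_symm_apply] at key

/-- **Middle steps**: consecutive nearest sites of points at distance `≤ ℓ`, `ℓ + 2δ ≤ 12kδ`. [folklore] -/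
theorem corridorChain_step_mid (hδ : 0 < δ) {ℓ : ℝ} (hz : ∀ j, j < J → dist (z (j + 1)) (z j) ≤ ℓ)
    (hℓ : ℓ + 2 * δ ≤ 12 * k * δ) {i : ℕ} (hi1 : 1 ≤ i) (hi2 : i ≤ J) :
    corridorChain oy ox δ a b t S T k J M z (i + 1) ∈ mB (corridorChain oy ox δ a b t S T k J M z i) k := by
  rw [corridorChain_mid hi1 (by omega), corridorChain_mid (by omega) (by omega), frame_mem_mB_iff,
    show i + 1 - 1 = (i - 1) + 1 by omega]
  apply mem_mB_of_norm_meshPoint_sub_le hδ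
  have h := hz (i - 1) (by omega)
  calc ‖meshPoint δ (nearestSite δ (z (i - 1 + 1))) - meshPoint δ (nearestSite δ (z (i - 1)))‖
      ≤ ‖meshPoint δ (nearestSite δ (z (i - 1 + 1))) - z (i - 1 + 1)‖ + ‖z (i - 1 + 1) - z (i - 1)‖ +
        ‖z (i - 1) - meshPoint δ (nearestSite δ (z (i - 1)))‖ := by
          have := norm_sub_le_norm_sub_add_norm_sub (meshPoint δ (nearestSite δ (z (i - 1 + 1)))) (z (i - 1 + 1))
            (meshPoint δ (nearestSite δ (z (i - 1))))
          have := norm_sub_le_norm_sub_add_norm_sub (z (i - 1 + 1)) (z (i - 1)) (meshPoint δ (nearestSite δ (z (i - 1))))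
          linarith
    _ ≤ δ + ℓ + δ := by
        refine add_le_add (add_le_add ?_ ?_) ?_
        · rw [← dist_eq_norm]; exact dist_meshPoint_nearestSite_le hδ _
        · rw [← dist_eq_norm]; exact h
        · rw [← dist_eq_norm, dist_comm]; exact dist_meshPoint_nearestSite_le hδ _
    _ ≤ δ * (12 * k) := by linarith

/-- The mesh point of the `m`-th sweep centre (original coordinates). [folklore] -/
theorem meshPoint_sweepCentre (m : ℕ) :
    meshPoint δ ((frame ox).symm (sweepCentre ox a S T k m)) =
      meshPoint δ a + (δ : ℂ) * ((((-(S : ℤ) + 12 * k * m : ℤ) : ℝ) : ℂ) * e ox + ((((T : ℤ) - 1 : ℤ) : ℝ) : ℂ) * ν ox) := by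
  rw [meshPoint_frame_symm ox δ a]
  simp only [sweepCentre_apply_zero, sweepCentre_apply_one]
  push_cast; ring

/-- **Junction step**: from the last interior centre `z J` to the first sweep centre, when the
latter's mesh point is within `η` of `z J` and `η + δ ≤ 12kδ`. [folklore] -/
theorem corridorChain_step_junction (hδ : 0 < δ) {η : ℝ}
    (hJ : ‖meshPoint δ a + (δ : ℂ) * ((((-(S : ℤ) : ℤ) : ℝ) : ℂ) * e ox + ((((T : ℤ) - 1 : ℤ) : ℝ) : ℂ) * ν ox) - z J‖ ≤ η)
    (hη : η + δ ≤ 12 * k * δ) :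
    corridorChain oy ox δ a b t S T k J M z (J + 2) ∈ mB (corridorChain oy ox δ a b t S T k J M z (J + 1)) k := by
  rw [corridorChain_sweep le_rfl, corridorChain_mid (by omega) le_rfl, frame_mem_mB_iff, Nat.sub_self,
    Nat.zero_min, show J + 1 - 1 = J by omega]
  apply mem_mB_of_norm_meshPoint_sub_le hδ
  rw [meshPoint_sweepCentre]
  simp only [Nat.cast_zero, mul_zero, add_zero]
  calc ‖meshPoint δ a + (δ : ℂ) * ((((-(S : ℤ) : ℤ) : ℝ) : ℂ) * e ox + ((((T : ℤ) - 1 : ℤ) : ℝ) : ℂ) * ν ox) -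
        meshPoint δ (nearestSite δ (z J))‖
      ≤ ‖meshPoint δ a + (δ : ℂ) * ((((-(S : ℤ) : ℤ) : ℝ) : ℂ) * e ox + ((((T : ℤ) - 1 : ℤ) : ℝ) : ℂ) * ν ox) - z J‖ +
        ‖z J - meshPoint δ (nearestSite δ (z J))‖ := norm_sub_le_norm_sub_add_norm_sub _ _ _
    _ ≤ η + δ := add_le_add hJ (by rw [← dist_eq_norm, dist_comm]; exact dist_meshPoint_nearestSite_le hδ _)
    _ ≤ δ * (12 * k) := by linarith

/-- **Sweep steps**: consecutive sweep centres differ by `(12k, 0)` (or coincide). [folklore] -/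
theorem corridorChain_step_sweep {i : ℕ} (hi : J + 2 ≤ i) :
    corridorChain oy ox δ a b t S T k J M z (i + 1) ∈ mB (corridorChain oy ox δ a b t S T k J M z i) k := by
  rw [corridorChain_sweep hi, corridorChain_sweep (by omega), frame_mem_mB_iff]
  have key : ∀ m m' : ℕ, (m' = m ∨ m' = m + 1) →
      (frame ox).symm (sweepCentre ox a S T k m') ∈ mB ((frame ox).symm (sweepCentre ox a S T k m)) k := by
    intro m m' hmm'
    have := frame_mem_mB_iff ox ((frame ox).symm (sweepCentre ox a S T k m))
      ((frame ox).symm (sweepCentre ox a S T k m')) k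
    rw [Equiv.apply_symm_apply, Equiv.apply_symm_apply] at this
    rw [← this]
    have hk0 : (0 : ℤ) ≤ 12 * (k : ℤ) := by positivity
    constructor
    · rw [sweepCentre_apply_zero, sweepCentre_apply_zero, abs_le]
      rcases hmm' with rfl | rfl
      · constructor
        · nlinarith
        · nlinarith
      · constructor
        · push_cast; nlinarith
        · push_cast; nlinarith
    · rw [sweepCentre_apply_one, sweepCentre_apply_one, sub_self, abs_zero]; positivity
  apply key
  rcases le_or_gt M (i - (J + 2)) with h | h
  · left; rw [min_eq_right h, min_eq_right (by omega)]
  · right; rw [min_eq_left h.le, min_eq_left (by omega)]; omega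

/-- **All steps of the corridor chain are short** (the hypothesis `hsteps` of
`dirichletGreen_chain_ge`, for every index). [folklore] -/
theorem corridorChain_step (hδ : 0 < δ) {η ℓ : ℝ}
    (h0 : ‖meshPoint δ b + (δ : ℂ) * ((((t : ℤ) - 1 : ℤ) : ℝ) : ℂ) * ν oy - z 0‖ ≤ η)
    (hJ : ‖meshPoint δ a + (δ : ℂ) * ((((-(S : ℤ) : ℤ) : ℝ) : ℂ) * e ox + ((((T : ℤ) - 1 : ℤ) : ℝ) : ℂ) * ν ox) - z J‖ ≤ η)
    (hz : ∀ j, j < J → dist (z (j + 1)) (z j) ≤ ℓ)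
    (hη : η + δ ≤ 12 * k * δ) (hℓ : ℓ + 2 * δ ≤ 12 * k * δ) (i : ℕ) :
    corridorChain oy ox δ a b t S T k J M z (i + 1) ∈ mB (corridorChain oy ox δ a b t S T k J M z i) k := by
  rcases Nat.eq_zero_or_pos i with hi | hi
  · rw [hi]; exact corridorChain_step_zero hδ h0 hη
  by_cases hi2 : i ≤ J
  · exact corridorChain_step_mid hδ hz hℓ hi hi2
  by_cases hi3 : i = J + 1
  · rw [hi3]; exact corridorChain_step_junction hδ hJ hη
  · exact corridorChain_step_sweep (by omega)

/-! ### The final boxes cover the top side -/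

/-- **Covering of the top side**: every point `w'` of the top side
`{w'₁ = (σₓ a)₁ - 1 + T, |w'₀ - (σₓ a)₀| < S}` of the rectangle lies in the small box of some
sweep centre `m ≤ M` (`2S ≤ 12kM`, `k ≥ 1`), hence (in the frame of the pole) in
`mB (corridorChain … (J + 2 + m)) k`. [folklore] -/
theorem exists_mem_mB_corridorChain (hk : 0 < k) (hM : 2 * S ≤ 12 * k * M) {w' : Site 2}
    (hw1 : w' 1 = frame ox a 1 - 1 + T) (hw0 : frame ox a 0 - S < w' 0) (hw0' : w' 0 < frame ox a 0 + S) :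
    ∃ m, m ≤ M ∧ frame oy ((frame ox).symm w') ∈ mB (corridorChain oy ox δ a b t S T k J M z (J + 2 + m)) k := by
  -- the index
  set d : ℤ := w' 0 - (frame ox a 0 - S) with hd
  have hd0 : 0 < d := by omega
  have hd2 : d < 2 * S := by omega
  set n : ℕ := d.toNat with hn
  have hdnat : (n : ℤ) = d := Int.toNat_of_nonneg hd0.le
  set m : ℕ := n / (12 * k) with hm
  have hk12 : 0 < 12 * k := by omega
  have hm1 : m * (12 * k) ≤ n := Nat.div_mul_le_self _ _
  have hm2 : n < 12 * k * (m + 1) := Nat.lt_mul_div_succ n hk12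
  have hm1' : (m : ℤ) * (12 * k) ≤ d := by rw [← hdnat]; exact_mod_cast hm1
  have hm2' : d < 12 * (k : ℤ) * (m + 1) := by rw [← hdnat]; exact_mod_cast hm2
  have hM' : 2 * (S : ℤ) ≤ 12 * k * M := by exact_mod_cast hM
  have hmM : m ≤ M := by
    by_contra h
    push Not at h
    have h1 : (M : ℤ) + 1 ≤ m := by exact_mod_cast h
    have h2 : 12 * (k : ℤ) * (M + 1) ≤ 12 * k * m := by
      have hk0 : (0 : ℤ) ≤ 12 * k := by positivity
      nlinarith
    nlinarith
  refine ⟨m, hmM, ?_⟩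
  rw [corridorChain_sweep (Nat.le_add_right _ _), Nat.add_sub_cancel_left, min_eq_left hmM,
    frame_mem_mB_iff]
  have := frame_mem_mB_iff ox ((frame ox).symm (sweepCentre ox a S T k m)) ((frame ox).symm w') k
  rw [Equiv.apply_symm_apply, Equiv.apply_symm_apply] at this
  rw [← this]
  constructor
  · rw [sweepCentre_apply_zero, abs_le]
    constructor
    · nlinarith
    · nlinarith
  · rw [sweepCentre_apply_one, hw1, sub_self, abs_zero]; positivity

end Corridor

end Literature.Probability.LatticeModels
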